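import Summits.RiemannHypothesis.RiemannHypothesis.Theorems.GapsEvoDoorsInOptDefs
import Mathlib.Analysis.SpecialFunctions.Trigonometric.Sinc

/-!
# GapsEvoDoors — IN-OPT certificate, part 1: Taylor sign kernel, rational minorants, Beta sums

Re-proves (the tree's copies in `ZetaGapRecordsInoueNumerics` are private) the alternating-Taylor
sign kernel `S₇(y) ≤ sin y`, `cos y ≤ C₁₂(y)` on `[0,∞)`, derives the RATIONAL minorants `pLo(u) ≤
sin(xu)/u`, `qLo(u) ≤ sin²(xu)/u` (`u > 0`) uniformly for `x ∈ [xLo, xHi]`, `pLo ≥ 0` on `[0,1]`,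
and the Finset-sum Beta evaluations `∫₀¹ (Σ aₙu^{dₙ})(1−u)^t`, `∫₀^b (Σ aₙx^{dₙ})(b−x)^t`. computed-
record rung: executes the higher-degree optimisation anticipated in Inoue 2026 (arXiv:2604.05733)
Remark 1; no printed constant below 0.508949 under RH alone as of 2026-08; instrument rows eng-2
j289119/j289121, eng-1 R-aIN-E1-g0-01 j289591/j289692/j289724, referee VERDICTS.md 3e883a7033d14144
V-2/V-3/V-4; PREREG A1 cd26ffc3f46dafba; conditional on RH and on `inoue2026_theorem2` (preprint
CLAIM); μ-currency RECORD class, not the CI door; computed ≠ proved outside this kernel certificate;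
nothing here bears on the truth of RH.
-/

noncomputable section

open MeasureTheory Set Finset Real Literature.NumberTheory.LFunctions

open scoped Real Interval

set_option linter.dupNamespace false  -- the mandated namespace repeats `RiemannHypothesis`

namespace Summit.RiemannHypothesis.RiemannHypothesis.Theorems.GapsEvoDoorsInOpt

/-! ### 1. Alternating Taylor sign kernel (as in `ZetaGapRecordsInoueNumerics`, re-proved here) -/

/-- `d/dx Σ_{n≤N} (−1)ⁿx^{2n+1}/(2n+1)! = Σ_{n≤N} (−1)ⁿx^{2n}/(2n)!`. [folklore] -/
theorem hasDerivAt_sinTaylor (N : ℕ) (x : ℝ) :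
    HasDerivAt (fun y : ℝ => ∑ n ∈ range (N + 1), (-1 : ℝ) ^ n * y ^ (2 * n + 1) / ((2 * n + 1).factorial : ℝ))
      (∑ n ∈ range (N + 1), (-1 : ℝ) ^ n * x ^ (2 * n) / ((2 * n).factorial : ℝ)) x := by
  apply HasDerivAt.fun_sum
  intro n _
  refine (((hasDerivAt_pow (2 * n + 1) x).const_mul ((-1 : ℝ) ^ n)).div_const ((2 * n + 1).factorial : ℝ)).congr_deriv ?_
  rw [Nat.factorial_succ, Nat.add_sub_cancel]
  have h1 : ((2 * n).factorial : ℝ) ≠ 0 := by positivity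
  push_cast
  field_simp

/-- `d/dx Σ_{n≤N+1} (−1)ⁿx^{2n}/(2n)! = −Σ_{n≤N} (−1)ⁿx^{2n+1}/(2n+1)!`. [folklore] -/
theorem hasDerivAt_cosTaylor (N : ℕ) (x : ℝ) :
    HasDerivAt (fun y : ℝ => ∑ n ∈ range (N + 2), (-1 : ℝ) ^ n * y ^ (2 * n) / ((2 * n).factorial : ℝ))
      (-(∑ n ∈ range (N + 1), (-1 : ℝ) ^ n * x ^ (2 * n + 1) / ((2 * n + 1).factorial : ℝ))) x := by
  have h : HasDerivAt (fun y : ℝ => ∑ n ∈ range (N + 2), (-1 : ℝ) ^ n * y ^ (2 * n) / ((2 * n).factorial : ℝ))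
      (∑ n ∈ range (N + 2), (-1 : ℝ) ^ n * (((2 * n : ℕ) : ℝ) * x ^ (2 * n - 1)) / ((2 * n).factorial : ℝ)) x := by
    apply HasDerivAt.fun_sum
    intro n _
    exact ((hasDerivAt_pow (2 * n) x).const_mul ((-1 : ℝ) ^ n)).div_const _
  refine h.congr_deriv ?_
  rw [Finset.sum_range_succ' (fun n => (-1 : ℝ) ^ n * (((2 * n : ℕ) : ℝ) * x ^ (2 * n - 1)) / ((2 * n).factorial : ℝ))]
  simp only [mul_zero, Nat.cast_zero, zero_mul, zero_div, add_zero]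
  rw [← Finset.sum_neg_distrib]
  refine Finset.sum_congr rfl fun n _ => ?_
  have e1 : 2 * (n + 1) - 1 = 2 * n + 1 := by omega
  have e2 : (2 * (n + 1)).factorial = (2 * n + 2) * (2 * n + 1).factorial := by
    rw [show 2 * (n + 1) = (2 * n + 1) + 1 by ring, Nat.factorial_succ]
  rw [e1, e2, pow_succ (-1 : ℝ) n]
  have h1 : ((2 * n + 1).factorial : ℝ) ≠ 0 := by positivity
  have h2 : (2 * (n : ℝ) + 2) ≠ 0 := by positivity
  push_cast
  field_simp

/-- A function vanishing at `0` with derivative `≥ 0` on `[0, ∞)` is `≥ 0` there. [folklore] -/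
theorem nonneg_of_hasDerivAt_nonneg {g g' : ℝ → ℝ} (hd : ∀ x, HasDerivAt g (g' x) x)
    (hg' : ∀ x, 0 ≤ x → 0 ≤ g' x) (h0 : g 0 = 0) (x : ℝ) (hx : 0 ≤ x) : 0 ≤ g x := by
  have hmono : MonotoneOn g (Set.Ici 0) :=
    monotoneOn_of_hasDerivWithinAt_nonneg (convex_Ici 0) (fun y _ => (hd y).continuousAt.continuousWithinAt)
      (fun y _ => (hd y).hasDerivWithinAt) (fun y hy => hg' y (le_of_lt (by simpa [interior_Ici] using hy)))
  simpa [h0] using hmono Set.self_mem_Ici hx hx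

/-- Sign of the `cos` remainder of order `2N` ⇒ sign of the `sin` remainder of order `2N+1`. [folklore] -/
theorem sinTaylor_sign_of_cosTaylor_sign (N : ℕ)
    (h : ∀ x : ℝ, 0 ≤ x →
      0 ≤ (-1 : ℝ) ^ (N + 1) * (Real.cos x - ∑ n ∈ range (N + 1), (-1 : ℝ) ^ n * x ^ (2 * n) / ((2 * n).factorial : ℝ))) :
    ∀ x : ℝ, 0 ≤ x →
      0 ≤ (-1 : ℝ) ^ (N + 1) * (Real.sin x - ∑ n ∈ range (N + 1), (-1 : ℝ) ^ n * x ^ (2 * n + 1) / ((2 * n + 1).factorial : ℝ)) :=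
  nonneg_of_hasDerivAt_nonneg (fun x => ((Real.hasDerivAt_sin x).sub (hasDerivAt_sinTaylor N x)).const_mul _) h
    (by simp)

/-- Sign of the `sin` remainder of order `2N+1` ⇒ sign of the `cos` remainder of order `2N+2`. [folklore] -/
theorem cosTaylor_sign_succ_of_sinTaylor_sign (N : ℕ)
    (h : ∀ x : ℝ, 0 ≤ x →
      0 ≤ (-1 : ℝ) ^ (N + 1) * (Real.sin x - ∑ n ∈ range (N + 1), (-1 : ℝ) ^ n * x ^ (2 * n + 1) / ((2 * n + 1).factorial : ℝ))) :
    ∀ x : ℝ, 0 ≤ x →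
      0 ≤ (-1 : ℝ) ^ (N + 2) * (Real.cos x - ∑ n ∈ range (N + 2), (-1 : ℝ) ^ n * x ^ (2 * n) / ((2 * n).factorial : ℝ)) := by
  refine nonneg_of_hasDerivAt_nonneg (fun x => ((Real.hasDerivAt_cos x).sub (hasDerivAt_cosTaylor N x)).const_mul _)
    (fun x hx => ?_) (by simp [Finset.sum_range_succ'])
  have e : (-1 : ℝ) ^ (N + 2) *
      (-Real.sin x - -(∑ n ∈ range (N + 1), (-1 : ℝ) ^ n * x ^ (2 * n + 1) / ((2 * n + 1).factorial : ℝ)))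
      = (-1 : ℝ) ^ (N + 1) *
        (Real.sin x - ∑ n ∈ range (N + 1), (-1 : ℝ) ^ n * x ^ (2 * n + 1) / ((2 * n + 1).factorial : ℝ)) := by
    rw [pow_succ]; ring
  rw [e]; exact h x hx

/-- For `x ≥ 0` the `cos` Taylor remainder of order `2N` has the sign `(−1)^{N+1}`. [folklore] -/
theorem cosTaylor_sign (N : ℕ) : ∀ (x : ℝ), 0 ≤ x →
    0 ≤ (-1 : ℝ) ^ (N + 1) * (Real.cos x - ∑ n ∈ range (N + 1), (-1 : ℝ) ^ n * x ^ (2 * n) / ((2 * n).factorial : ℝ)) := by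
  induction N with
  | zero =>
    intro x _
    have := Real.cos_le_one x
    simp only [zero_add, pow_one, Finset.sum_range_one, pow_zero, mul_zero, Nat.factorial_zero, Nat.cast_one,
      div_one, mul_one]
    linarith
  | succ N ih =>
    intro x hx
    exact cosTaylor_sign_succ_of_sinTaylor_sign N (sinTaylor_sign_of_cosTaylor_sign N ih) x hx

/-- For `x ≥ 0` the `sin` Taylor remainder of order `2N+1` has the sign `(−1)^{N+1}`. [folklore] -/
theorem sinTaylor_sign (N : ℕ) (x : ℝ) (hx : 0 ≤ x) :
    0 ≤ (-1 : ℝ) ^ (N + 1) *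
      (Real.sin x - ∑ n ∈ range (N + 1), (-1 : ℝ) ^ n * x ^ (2 * n + 1) / ((2 * n + 1).factorial : ℝ)) :=
  sinTaylor_sign_of_cosTaylor_sign N (cosTaylor_sign N) x hx

/-- `S₇(y) ≤ sin y` for `y ≥ 0`, written out. [folklore] -/
theorem sinTaylor7_le_sin (y : ℝ) (hy : 0 ≤ y) :
    y - y ^ 3 / 6 + y ^ 5 / 120 - y ^ 7 / 5040 ≤ Real.sin y := by
  have h := sinTaylor_sign 3 y hy
  simp only [Finset.sum_range_succ, Finset.sum_range_zero] at h
  norm_num [Nat.factorial] at h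
  linarith

/-- `cos y ≤ C₁₂(y)` for `y ≥ 0`, written out. [folklore] -/
theorem cos_le_cosTaylor12 (y : ℝ) (hy : 0 ≤ y) :
    Real.cos y ≤ 1 - y ^ 2 / 2 + y ^ 4 / 24 - y ^ 6 / 720 + y ^ 8 / 40320 - y ^ 10 / 3628800
      + y ^ 12 / 479001600 := by
  have h := cosTaylor_sign 6 y hy
  simp only [Finset.sum_range_succ, Finset.sum_range_zero] at h
  norm_num [Nat.factorial] at h
  linarith

/-! ### 2. Rational minorants of `sin(xu)/u` and `sin²(xu)/u` on `(0,1]`, uniformly for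
`x ∈ [1598567/10⁶, 15985682/10⁷]` (an interval containing `π·0.50884`) -/

/-- `0 < xLo`. -/
theorem xLo_pos : 0 < xLo := by unfold xLo; norm_num

/-- `pLo(u) ≤ sin(xu)/u` for `x ∈ [xLo, xHi]`, `u > 0`. [folklore] -/
theorem pLo_le_sin_div {x u : ℝ} (hx1 : xLo ≤ x) (hx2 : x ≤ xHi) (hu : 0 < u) :
    pLo u ≤ Real.sin (x * u) / u := by
  have hx0 : 0 ≤ x := le_trans xLo_pos.le hx1
  have hxu : 0 ≤ x * u := by positivity
  have hS := sinTaylor7_le_sin (x * u) hxu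
  rw [le_div_iff₀ hu]
  have hxlo0 : 0 ≤ xLo := xLo_pos.le
  -- termwise: xLo^{2m+1} ≤ x^{2m+1} ≤ xHi^{2m+1}
  have h1 : xLo ≤ x := hx1
  have h3 : x ^ 3 ≤ xHi ^ 3 := pow_le_pow_left₀ hx0 hx2 3
  have h5 : xLo ^ 5 ≤ x ^ 5 := pow_le_pow_left₀ hxlo0 hx1 5
  have h7 : x ^ 7 ≤ xHi ^ 7 := pow_le_pow_left₀ hx0 hx2 7
  have hu2 : 0 ≤ u ^ 2 := by positivity
  have hu4 : 0 ≤ u ^ 4 := by positivity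
  have hu6 : 0 ≤ u ^ 6 := by positivity
  have e : (x * u) - (x * u) ^ 3 / 6 + (x * u) ^ 5 / 120 - (x * u) ^ 7 / 5040
      = (x - x ^ 3 / 6 * u ^ 2 + x ^ 5 / 120 * u ^ 4 - x ^ 7 / 5040 * u ^ 6) * u := by ring
  rw [e] at hS
  have hle : pLo u * u ≤ (x - x ^ 3 / 6 * u ^ 2 + x ^ 5 / 120 * u ^ 4 - x ^ 7 / 5040 * u ^ 6) * u := by
    apply mul_le_mul_of_nonneg_right _ hu.le
    unfold pLo
    nlinarith [mul_le_mul_of_nonneg_right h3 hu2, mul_le_mul_of_nonneg_right h5 hu4,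
      mul_le_mul_of_nonneg_right h7 hu6]
  exact le_trans hle hS

/-- `pLo ≥ 0` on `[0, 1]`. [folklore] -/
theorem pLo_nonneg {u : ℝ} (hu0 : 0 ≤ u) (hu1 : u ≤ 1) : 0 ≤ pLo u := by
  unfold pLo xLo xHi
  have hu2 : u ^ 2 ≤ 1 := by nlinarith
  have hu6 : u ^ 6 ≤ 1 := by
    have := pow_le_one₀ (n := 6) hu0 hu1; exact this
  have hu4 : 0 ≤ u ^ 4 := by positivity
  nlinarith

/-- `qLo(u) ≤ sin²(xu)/u` for `x ∈ [xLo, xHi]`, `u > 0`. [folklore] -/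
theorem qLo_le_sin_sq_div {x u : ℝ} (hx1 : xLo ≤ x) (hx2 : x ≤ xHi) (hu : 0 < u) :
    qLo u ≤ Real.sin (x * u) ^ 2 / u := by
  have hx0 : 0 ≤ x := le_trans xLo_pos.le hx1
  have hxu : 0 ≤ 2 * (x * u) := by positivity
  have hC := cos_le_cosTaylor12 (2 * (x * u)) hxu
  have hsq : Real.sin (x * u) ^ 2 = 1 / 2 - Real.cos (2 * (x * u)) / 2 := by
    rw [Real.sin_sq, Real.cos_sq]; ring
  rw [le_div_iff₀ hu, hsq]
  have hxlo0 : 0 ≤ 2 * xLo := by have := xLo_pos; linarith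
  have h2x0 : 0 ≤ 2 * x := by positivity
  have a2 : (2 * xLo) ^ 2 ≤ (2 * x) ^ 2 := pow_le_pow_left₀ hxlo0 (by linarith) 2
  have a4 : (2 * x) ^ 4 ≤ (2 * xHi) ^ 4 := pow_le_pow_left₀ h2x0 (by linarith) 4
  have a6 : (2 * xLo) ^ 6 ≤ (2 * x) ^ 6 := pow_le_pow_left₀ hxlo0 (by linarith) 6
  have a8 : (2 * x) ^ 8 ≤ (2 * xHi) ^ 8 := pow_le_pow_left₀ h2x0 (by linarith) 8
  have a10 : (2 * xLo) ^ 10 ≤ (2 * x) ^ 10 := pow_le_pow_left₀ hxlo0 (by linarith) 10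
  have a12 : (2 * x) ^ 12 ≤ (2 * xHi) ^ 12 := pow_le_pow_left₀ h2x0 (by linarith) 12
  have hu2 : 0 ≤ u ^ 2 := by positivity
  have hu4 : 0 ≤ u ^ 4 := by positivity
  have hu6 : 0 ≤ u ^ 6 := by positivity
  have hu8 : 0 ≤ u ^ 8 := by positivity
  have hu10 : 0 ≤ u ^ 10 := by positivity
  have hu12 : 0 ≤ u ^ 12 := by positivity
  -- (1 - C₁₂(2xu))/2 = Σ_k (-1)^k (2x)^{2k+2} u^{2k+2}/(2(2k+2)!)  and  qLo u * u is termwise below it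
  have e : 1 / 2 - (1 - (2 * (x * u)) ^ 2 / 2 + (2 * (x * u)) ^ 4 / 24 - (2 * (x * u)) ^ 6 / 720
        + (2 * (x * u)) ^ 8 / 40320 - (2 * (x * u)) ^ 10 / 3628800 + (2 * (x * u)) ^ 12 / 479001600) / 2
      = (2 * x) ^ 2 / 4 * u ^ 2 - (2 * x) ^ 4 / 48 * u ^ 4 + (2 * x) ^ 6 / 1440 * u ^ 6
        - (2 * x) ^ 8 / 80640 * u ^ 8 + (2 * x) ^ 10 / 7257600 * u ^ 10 - (2 * x) ^ 12 / 958003200 * u ^ 12 := by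
    ring
  have hq : qLo u * u ≤ (2 * x) ^ 2 / 4 * u ^ 2 - (2 * x) ^ 4 / 48 * u ^ 4 + (2 * x) ^ 6 / 1440 * u ^ 6
        - (2 * x) ^ 8 / 80640 * u ^ 8 + (2 * x) ^ 10 / 7257600 * u ^ 10 - (2 * x) ^ 12 / 958003200 * u ^ 12 := by
    unfold qLo
    have eq : ((2 * xLo) ^ 2 / 4 * u - (2 * xHi) ^ 4 / 48 * u ^ 3 + (2 * xLo) ^ 6 / 1440 * u ^ 5
        - (2 * xHi) ^ 8 / 80640 * u ^ 7 + (2 * xLo) ^ 10 / 7257600 * u ^ 9 - (2 * xHi) ^ 12 / 958003200 * u ^ 11) * u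
        = (2 * xLo) ^ 2 / 4 * u ^ 2 - (2 * xHi) ^ 4 / 48 * u ^ 4 + (2 * xLo) ^ 6 / 1440 * u ^ 6
          - (2 * xHi) ^ 8 / 80640 * u ^ 8 + (2 * xLo) ^ 10 / 7257600 * u ^ 10 - (2 * xHi) ^ 12 / 958003200 * u ^ 12 := by
      ring
    rw [eq]
    nlinarith [mul_le_mul_of_nonneg_right a2 hu2, mul_le_mul_of_nonneg_right a4 hu4,
      mul_le_mul_of_nonneg_right a6 hu6, mul_le_mul_of_nonneg_right a8 hu8,
      mul_le_mul_of_nonneg_right a10 hu10, mul_le_mul_of_nonneg_right a12 hu12]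
  linarith [hq, hC, e]

/-! ### 3. Generic Beta-sum evaluations (the tree's `integral_pow_mul_one_sub_rpow` /
`integral_pow_mul_sub_rpow` summed over a Finset) -/

/-- `u ↦ (b − u)^t` is continuous for `t ≥ 0`. [folklore] -/
theorem continuous_sub_rpow (b : ℝ) {t : ℝ} (ht : 0 ≤ t) :
    Continuous fun u : ℝ => (b - u) ^ t :=
  (continuous_const.sub continuous_id).rpow_const fun _ => Or.inr ht

/-- `∫₀¹ (Σ_{n<N} aₙ u^{dₙ}) (1−u)^t du = Σ_{n<N} aₙ J(dₙ, t)` (`t > 0`). [folklore] -/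
theorem integral_polySum_mul_rpow (N : ℕ) (a : ℕ → ℝ) (d : ℕ → ℕ) {t : ℝ} (ht : 0 < t) :
    ∫ u in (0 : ℝ)..1, (∑ n ∈ range N, a n * u ^ d n) * (1 - u) ^ t = ∑ n ∈ range N, a n * betaJ (d n) t := by
  have e1 : ∀ u : ℝ, (∑ n ∈ range N, a n * u ^ d n) * (1 - u) ^ t
      = ∑ n ∈ range N, a n * (u ^ d n * (1 - u) ^ t) := by
    intro u; rw [Finset.sum_mul]; refine Finset.sum_congr rfl fun n _ => ?_; ring
  simp_rw [e1]
  rw [intervalIntegral.integral_finsetSum]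
  · refine Finset.sum_congr rfl fun n _ => ?_
    rw [intervalIntegral.integral_const_mul,
      Literature.NumberTheory.LFunctions.Inoue2026.Numerics.integral_pow_mul_one_sub_rpow (d n) ht]
    rfl
  · intro n _
    have hc : Continuous fun u : ℝ => (1 - u) ^ t := continuous_sub_rpow 1 ht.le
    exact (Continuous.intervalIntegrable (by fun_prop) _ _)

/-- Scaled version: `∫₀^b (Σ_{n<N} aₙ x^{dₙ}) (b−x)^t dx = Σ_{n<N} aₙ b^{dₙ+1} b^t J(dₙ,t)` (`b ≥ 0`). [folklore] -/
theorem integral_polySum_mul_sub_rpow (N : ℕ) (a : ℕ → ℝ) (d : ℕ → ℕ) {t : ℝ} (ht : 0 < t)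
    {b : ℝ} (hb : 0 ≤ b) :
    ∫ x in (0 : ℝ)..b, (∑ n ∈ range N, a n * x ^ d n) * (b - x) ^ t
      = ∑ n ∈ range N, a n * (b ^ (d n + 1) * b ^ t * betaJ (d n) t) := by
  have e1 : ∀ u : ℝ, (∑ n ∈ range N, a n * u ^ d n) * (b - u) ^ t
      = ∑ n ∈ range N, a n * (u ^ d n * (b - u) ^ t) := by
    intro u; rw [Finset.sum_mul]; refine Finset.sum_congr rfl fun n _ => ?_; ring
  simp_rw [e1]
  rw [intervalIntegral.integral_finsetSum]
  · refine Finset.sum_congr rfl fun n _ => ?_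
    rw [intervalIntegral.integral_const_mul,
      Literature.NumberTheory.LFunctions.Inoue2026.Numerics.integral_pow_mul_sub_rpow (d n) ht hb]
    rfl
  · intro n _
    have hc : Continuous fun u : ℝ => (b - u) ^ t := continuous_sub_rpow b ht.le
    exact (Continuous.intervalIntegrable (by fun_prop) _ _)

end Summit.RiemannHypothesis.RiemannHypothesis.Theorems.GapsEvoDoorsInOpt

end
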